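import Summits.KontsevichZagierPeriods.KontsevichZagierPeriods.Theorems.SymplecticScissorsRealOnePeriodRelationsTorsionLayerC
import Summits.KontsevichZagierPeriods.KontsevichZagierPeriods.Theorems.SymplecticScissorsRealOnePeriodRelationsConicLayer

/-!
# Crux `RealOnePeriodRelations` (stmt-KontsevichZagierPeriods-10042), line `nash-retraction-thin-strip`, lead c8 (cycle 10):
# the UNIFIED unconditional layer — genus 0 and the non-CM elliptic sector in ONE relation module

The layers of the line were landed class by class (Rat, AlgRat, Conic, Ell, Iso, MultiEll, Torsion, TorsionC); each layer theorem
speaks about relations INSIDE its own generator class.  This file glues them into ONE theorem about MIXED relations: every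
`ℤ`-combination with value `0` of
* rational representations (`IsRational`), algebraic-rational cells `∫_a^b P/Q` over `ℚ̄ ∩ ℝ` (logarithms, `π`, …),
* conic cells `∫_a^b P dx/(Q √(αx² + βx + γ))` of both Euler types,
* first/second-kind elliptic cells and tails on the real curves `E_j : y² = x³ + A_j x + B_j` of a non-CM isogeny web,
* third-kind `(P, D)`-torsion cells (complex torsion poles allowed) and torsion tails on the `E_j`,
lies in `M₁`.  Proof: `SectorGlue.realOnePeriodRelations_of_sector` over the reshape-10 apex sector
`huberWustholzCurvePeriods_torsionPunctured_family` (torsion-punctured curves ∪ `E`'s ∪ punctured lines ∪ `𝔾ₘ` ∪ `𝔸¹`), with CELLS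
`unifiedCells_family` (conic cells → algebraic-rational cells by the Euler substitutions `ConicLayer.stub_eulerLeadCell/RootCell`, rule 2;
algebraic-rational cells → unit rational cells by `ConicLayer.stub_algRatCells`; elliptic cells/tails by `IsoLayer.isoCells`; torsion tails by
`stub_torsTailC`) and the ARCS of reshape 11 (`torsLayerArcsC_family`).  No new transcendence input.
[cite: HuberWustholz2022, Thm 13.3 (2), §13.2] [cite: KontsevichZagier2001, §1.2]
-/

noncomputable section

open scoped BigOperators Topology PeriodPair
open Set Filter MvPolynomial Complex MeasureTheory
open Literature.NumberTheory.Transcendental Literature.NumberTheory.Transcendental.CurvePeriods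
open Literature.NumberTheory.Transcendental.CurvePeriods.Ell
open Summit.KontsevichZagierPeriods.SymplecticScissors.RealOnePeriodRelationsNegative (M₁ H₁)

namespace Summit.KontsevichZagierPeriods.SymplecticScissors.RealOnePeriodRelations

namespace TorsionLayer

/-- An algebraic-rational cell `∫_a^b P/Q` (`P, Q ∈ (ℚ̄ ∩ ℝ)[x]`) is, modulo `M₁`, a `ℤ`-combination of unit rational cells
(`ConicLayer.stub_algRatCells`). [cite: KontsevichZagier2001, §1.2] -/
theorem algRatCell_unitCells : ∀ r : KZ.IntegralRep 1, (∃ a b : ℝ, IsAlgebraic ℚ a ∧ IsAlgebraic ℚ b ∧ a < b ∧ r.domain = {z | z 0 ∈ Set.Ioo a b} ∧ ∃ P Q : Polynomial (algebraicClosure ℚ ℝ), (∀ x ∈ Set.Ioo a b, Polynomial.aeval x Q ≠ 0) ∧ ∀ x ∈ Set.Ioo a b, r.integrand (fun _ => x) = Polynomial.aeval x P / Polynomial.aeval x Q) → ∃ N : KZ.IntegralRep 1 →₀ ℤ, (∀ ρ ∈ N.support, ρ.domain = {z | z 0 ∈ Set.Ioo (0 : ℝ) 1} ∧ ∃ P Q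 : Polynomial (algebraicClosure ℚ ℝ), (∀ t ∈ Set.Ioo (0 : ℝ) 1, Polynomial.aeval t Q ≠ 0) ∧ ∀ t ∈ Set.Ioo (0 : ℝ) 1, ρ.integrand (fun _ => t) = Polynomial.aeval t P / Polynomial.aeval t Q) ∧ KZ.of r - N.sum (fun ρ m => m • KZ.of ρ) ∈ M₁ := by
  intro r hr
  exact ConicLayer.stub_algRatCells (KZ.of r) (AddSubgroup.subset_closure ⟨r, Or.inr hr, rfl⟩)

section Layer

variable {ι : Type} (A B : ι → ℝ) (L : ι → PeriodPair)

/-- CELLS of the unified layer: every generator is, modulo `M₁`, a `ℤ`-combination of unit rational cells, elliptic cells and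
`(P, D)`-torsion cells. [cite: KontsevichZagier2001, §1.2] -/
theorem unifiedCells_family (hA : ∀ j, IsAlgebraic ℚ (A j)) (hB : ∀ j, IsAlgebraic ℚ (B j))
    (hL₂ : ∀ j, (L j).g₂ = -4 * (A j : ℂ)) (hL₃ : ∀ j, (L j).g₃ = -4 * (B j : ℂ)) :
    ∀ c : KZ.FormalRep, c ∈ AddSubgroup.closure ((fun r : KZ.IntegralRep 1 => KZ.of r) ''
      {r | r.IsRational ∨
        (∃ a b : ℝ, IsAlgebraic ℚ a ∧ IsAlgebraic ℚ b ∧ a < b ∧ r.domain = {z | z 0 ∈ Set.Ioo a b} ∧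
          ∃ P Q : Polynomial (algebraicClosure ℚ ℝ), (∀ x ∈ Set.Ioo a b, Polynomial.aeval x Q ≠ 0) ∧
            ∀ x ∈ Set.Ioo a b, r.integrand (fun _ => x) = Polynomial.aeval x P / Polynomial.aeval x Q) ∨
        (∃ α β γ a b : ℝ, IsAlgebraic ℚ α ∧ IsAlgebraic ℚ β ∧ IsAlgebraic ℚ γ ∧ IsAlgebraic ℚ a ∧ IsAlgebraic ℚ b ∧ a < b ∧
          0 < α ∧ β ^ 2 - 4 * α * γ ≠ 0 ∧ (∀ x ∈ Set.Icc a b, 0 < α * x ^ 2 + β * x + γ) ∧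
          r.domain = {z | z 0 ∈ Set.Ioo a b} ∧
          ∃ P Q : Polynomial (algebraicClosure ℚ ℝ), (∀ x ∈ Set.Icc a b, Polynomial.aeval x Q ≠ 0) ∧
            ∀ z ∈ r.domain, r.integrand z =
              Polynomial.aeval (z 0) P / (Polynomial.aeval (z 0) Q * Real.sqrt (α * (z 0) ^ 2 + β * (z 0) + γ))) ∨
        (∃ α ρ ρ' a b : ℝ, IsAlgebraic ℚ α ∧ IsAlgebraic ℚ ρ ∧ IsAlgebraic ℚ ρ' ∧ IsAlgebraic ℚ a ∧ IsAlgebraic ℚ b ∧ a < b ∧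
          α < 0 ∧ ρ < a ∧ b < ρ' ∧ r.domain = {z | z 0 ∈ Set.Ioo a b} ∧
          ∃ P Q : Polynomial (algebraicClosure ℚ ℝ), (∀ x ∈ Set.Icc a b, Polynomial.aeval x Q ≠ 0) ∧
            ∀ z ∈ r.domain, r.integrand z =
              Polynomial.aeval (z 0) P / (Polynomial.aeval (z 0) Q * Real.sqrt (α * ((z 0) - ρ) * ((z 0) - ρ')))) ∨
        (∃ j, ∃ a b : ℝ, IsAlgebraic ℚ a ∧ IsAlgebraic ℚ b ∧ a < b ∧ r.domain = {z | z 0 ∈ Set.Ioo a b} ∧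
          (∀ x ∈ Set.Ioo a b, 0 < x ^ 3 + A j * x + B j) ∧
          ∃ P₁ P₂ P₃ : Polynomial (algebraicClosure ℚ ℝ), ∀ x ∈ Set.Ioo a b,
            r.integrand (fun _ => x) = Polynomial.aeval x P₁ + Polynomial.aeval x P₂ * Real.sqrt (x ^ 3 + A j * x + B j) +
              Polynomial.aeval x P₃ / Real.sqrt (x ^ 3 + A j * x + B j)) ∨
        (∃ j, ∃ e M' c₀ : ℝ, IsAlgebraic ℚ e ∧ IsAlgebraic ℚ M' ∧ IsAlgebraic ℚ c₀ ∧ e ^ 3 + A j * e + B j = 0 ∧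
          0 < 3 * e ^ 2 + A j ∧ e < M' ∧ (∀ x : ℝ, e < x → 0 < x ^ 3 + A j * x + B j) ∧ r.domain = {z | M' < z 0} ∧
          ∀ z ∈ r.domain, r.integrand z = c₀ / Real.sqrt ((z 0) ^ 3 + A j * (z 0) + B j)) ∨
        (∃ j, ∃ a b : ℝ, IsAlgebraic ℚ a ∧ IsAlgebraic ℚ b ∧ a < b ∧ r.domain = {z | z 0 ∈ Set.Ioo a b} ∧
          (∀ x ∈ Set.Ioo a b, 0 < x ^ 3 + A j * x + B j) ∧
          ∃ P D : Polynomial (algebraicClosure ℚ ℝ), (∀ x ∈ Set.Icc a b, Polynomial.aeval x D ≠ 0) ∧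
            (∀ z : ℂ, Polynomial.aeval z D = 0 →
              ∃ v : ℂ, v ∉ (L j).lattice ∧ (∃ n : ℕ, 1 ≤ n ∧ (n : ℂ) * v ∈ (L j).lattice) ∧ ℘[L j] v = z) ∧
            ∀ x ∈ Set.Ioo a b, r.integrand (fun _ => x) =
              Polynomial.aeval x P / (Polynomial.aeval x D * Real.sqrt (x ^ 3 + A j * x + B j))) ∨
        (∃ j, ∃ e M' : ℝ, IsAlgebraic ℚ e ∧ IsAlgebraic ℚ M' ∧ e ^ 3 + A j * e + B j = 0 ∧ 0 < 3 * e ^ 2 + A j ∧ e < M' ∧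
          (∀ x : ℝ, e < x → 0 < x ^ 3 + A j * x + B j) ∧ r.domain = {z | M' < z 0} ∧
          ∃ P D : Polynomial (algebraicClosure ℚ ℝ), P.natDegree ≤ D.natDegree ∧ (∀ x : ℝ, M' ≤ x → Polynomial.aeval x D ≠ 0) ∧
            (∀ z : ℂ, Polynomial.aeval z D = 0 →
              ∃ v : ℂ, v ∉ (L j).lattice ∧ (∃ n : ℕ, 1 ≤ n ∧ (n : ℂ) * v ∈ (L j).lattice) ∧ ℘[L j] v = z) ∧
            ∀ z ∈ r.domain, r.integrand z =
              Polynomial.aeval (z 0) P / (Polynomial.aeval (z 0) D * Real.sqrt ((z 0) ^ 3 + A j * (z 0) + B j)))}) →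
    ∃ N : KZ.IntegralRep 1 →₀ ℤ, (∀ ρ ∈ N.support,
      (ρ.domain = {z | z 0 ∈ Set.Ioo (0 : ℝ) 1} ∧
          ∃ P Q : Polynomial (algebraicClosure ℚ ℝ),
            (∀ t ∈ Set.Ioo (0 : ℝ) 1, Polynomial.aeval t Q ≠ 0) ∧
            ∀ t ∈ Set.Ioo (0 : ℝ) 1, ρ.integrand (fun _ => t) = Polynomial.aeval t P / Polynomial.aeval t Q) ∨
        (∃ j, ∃ a b : ℝ, IsAlgebraic ℚ a ∧ IsAlgebraic ℚ b ∧ a < b ∧ ρ.domain = {z | z 0 ∈ Set.Ioo a b} ∧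
          (∀ x ∈ Set.Ioo a b, 0 < x ^ 3 + A j * x + B j) ∧
          ∃ P₁ P₂ P₃ : Polynomial (algebraicClosure ℚ ℝ), ∀ x ∈ Set.Ioo a b,
            ρ.integrand (fun _ => x) = Polynomial.aeval x P₁ + Polynomial.aeval x P₂ * Real.sqrt (x ^ 3 + A j * x + B j) +
              Polynomial.aeval x P₃ / Real.sqrt (x ^ 3 + A j * x + B j)) ∨
        (∃ j, ∃ a b : ℝ, IsAlgebraic ℚ a ∧ IsAlgebraic ℚ b ∧ a < b ∧ ρ.domain = {z | z 0 ∈ Set.Ioo a b} ∧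
          (∀ x ∈ Set.Ioo a b, 0 < x ^ 3 + A j * x + B j) ∧
          ∃ P D : Polynomial (algebraicClosure ℚ ℝ), (∀ x ∈ Set.Icc a b, Polynomial.aeval x D ≠ 0) ∧
            (∀ z : ℂ, Polynomial.aeval z D = 0 →
              ∃ v : ℂ, v ∉ (L j).lattice ∧ (∃ n : ℕ, 1 ≤ n ∧ (n : ℂ) * v ∈ (L j).lattice) ∧ ℘[L j] v = z) ∧
            ∀ x ∈ Set.Ioo a b, ρ.integrand (fun _ => x) =
              Polynomial.aeval x P / (Polynomial.aeval x D * Real.sqrt (x ^ 3 + A j * x + B j)))) ∧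
      c - N.sum (fun ρ m => m • KZ.of ρ) ∈ M₁ := by
  classical
  intro c hc
  -- an algebraic-rational cell is, modulo `M₁`, a combination of unit rational cells
  have algRat : ∀ r : KZ.IntegralRep 1,
      (∃ a b : ℝ, IsAlgebraic ℚ a ∧ IsAlgebraic ℚ b ∧ a < b ∧ r.domain = {z | z 0 ∈ Set.Ioo a b} ∧
          ∃ P Q : Polynomial (algebraicClosure ℚ ℝ), (∀ x ∈ Set.Ioo a b, Polynomial.aeval x Q ≠ 0) ∧
            ∀ x ∈ Set.Ioo a b, r.integrand (fun _ => x) = Polynomial.aeval x P / Polynomial.aeval x Q) →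
      ∃ N : KZ.IntegralRep 1 →₀ ℤ, (∀ ρ ∈ N.support,
        (ρ.domain = {z | z 0 ∈ Set.Ioo (0 : ℝ) 1} ∧
          ∃ P Q : Polynomial (algebraicClosure ℚ ℝ),
            (∀ t ∈ Set.Ioo (0 : ℝ) 1, Polynomial.aeval t Q ≠ 0) ∧
            ∀ t ∈ Set.Ioo (0 : ℝ) 1, ρ.integrand (fun _ => t) = Polynomial.aeval t P / Polynomial.aeval t Q) ∨
        (∃ j, ∃ a b : ℝ, IsAlgebraic ℚ a ∧ IsAlgebraic ℚ b ∧ a < b ∧ ρ.domain = {z | z 0 ∈ Set.Ioo a b} ∧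
          (∀ x ∈ Set.Ioo a b, 0 < x ^ 3 + A j * x + B j) ∧
          ∃ P₁ P₂ P₃ : Polynomial (algebraicClosure ℚ ℝ), ∀ x ∈ Set.Ioo a b,
            ρ.integrand (fun _ => x) = Polynomial.aeval x P₁ + Polynomial.aeval x P₂ * Real.sqrt (x ^ 3 + A j * x + B j) +
              Polynomial.aeval x P₃ / Real.sqrt (x ^ 3 + A j * x + B j)) ∨
        (∃ j, ∃ a b : ℝ, IsAlgebraic ℚ a ∧ IsAlgebraic ℚ b ∧ a < b ∧ ρ.domain = {z | z 0 ∈ Set.Ioo a b} ∧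
          (∀ x ∈ Set.Ioo a b, 0 < x ^ 3 + A j * x + B j) ∧
          ∃ P D : Polynomial (algebraicClosure ℚ ℝ), (∀ x ∈ Set.Icc a b, Polynomial.aeval x D ≠ 0) ∧
            (∀ z : ℂ, Polynomial.aeval z D = 0 →
              ∃ v : ℂ, v ∉ (L j).lattice ∧ (∃ n : ℕ, 1 ≤ n ∧ (n : ℂ) * v ∈ (L j).lattice) ∧ ℘[L j] v = z) ∧
            ∀ x ∈ Set.Ioo a b, ρ.integrand (fun _ => x) =
              Polynomial.aeval x P / (Polynomial.aeval x D * Real.sqrt (x ^ 3 + A j * x + B j)))) ∧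
        KZ.of r - N.sum (fun ρ m => m • KZ.of ρ) ∈ M₁ := by
    intro r hr
    obtain ⟨N, hN, hrN⟩ := algRatCell_unitCells r hr
    exact ⟨N, fun ρ hρ => Or.inl (hN ρ hρ), hrN⟩
  refine AddSubgroup.closure_induction (p := fun c _ => ∃ N : KZ.IntegralRep 1 →₀ ℤ, (∀ ρ ∈ N.support,
      (ρ.domain = {z | z 0 ∈ Set.Ioo (0 : ℝ) 1} ∧
          ∃ P Q : Polynomial (algebraicClosure ℚ ℝ),
            (∀ t ∈ Set.Ioo (0 : ℝ) 1, Polynomial.aeval t Q ≠ 0) ∧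
            ∀ t ∈ Set.Ioo (0 : ℝ) 1, ρ.integrand (fun _ => t) = Polynomial.aeval t P / Polynomial.aeval t Q) ∨
        (∃ j, ∃ a b : ℝ, IsAlgebraic ℚ a ∧ IsAlgebraic ℚ b ∧ a < b ∧ ρ.domain = {z | z 0 ∈ Set.Ioo a b} ∧
          (∀ x ∈ Set.Ioo a b, 0 < x ^ 3 + A j * x + B j) ∧
          ∃ P₁ P₂ P₃ : Polynomial (algebraicClosure ℚ ℝ), ∀ x ∈ Set.Ioo a b,
            ρ.integrand (fun _ => x) = Polynomial.aeval x P₁ + Polynomial.aeval x P₂ * Real.sqrt (x ^ 3 + A j * x + B j) +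
              Polynomial.aeval x P₃ / Real.sqrt (x ^ 3 + A j * x + B j)) ∨
        (∃ j, ∃ a b : ℝ, IsAlgebraic ℚ a ∧ IsAlgebraic ℚ b ∧ a < b ∧ ρ.domain = {z | z 0 ∈ Set.Ioo a b} ∧
          (∀ x ∈ Set.Ioo a b, 0 < x ^ 3 + A j * x + B j) ∧
          ∃ P D : Polynomial (algebraicClosure ℚ ℝ), (∀ x ∈ Set.Icc a b, Polynomial.aeval x D ≠ 0) ∧
            (∀ z : ℂ, Polynomial.aeval z D = 0 →
              ∃ v : ℂ, v ∉ (L j).lattice ∧ (∃ n : ℕ, 1 ≤ n ∧ (n : ℂ) * v ∈ (L j).lattice) ∧ ℘[L j] v = z) ∧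
            ∀ x ∈ Set.Ioo a b, ρ.integrand (fun _ => x) =
              Polynomial.aeval x P / (Polynomial.aeval x D * Real.sqrt (x ^ 3 + A j * x + B j)))) ∧
      c - N.sum (fun ρ m => m • KZ.of ρ) ∈ M₁) ?_ ?_ ?_ ?_ hc
  · -- generators
    rintro _ ⟨r, hr, rfl⟩
    rcases hr with hrat | halg | ⟨α, β, γ, a, b, hα, hβ, hγ, ha, hb, hab, hα0, hdisc, hpos, hdom, P, Q, hQ, hint⟩ |
        ⟨α, ρ₀, ρ', a, b, hα, hρ₀, hρ', ha, hb, hab, hα0, hρa, hbρ', hdom, P, Q, hQ, hint⟩ | hcell | htail | htors |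
        ⟨j, e, M', he, hM', hfe, hfe', heM, hpos, hdom, P, D, hPD, hD0, hDt, hint⟩
    · obtain ⟨N, hN, hrN⟩ := IsoLayer.isoCells A B hA hB (KZ.of r) (AddSubgroup.subset_closure ⟨r, Or.inl hrat, rfl⟩)
      exact ⟨N, fun ρ hρ => (hN ρ hρ).elim Or.inl (fun h => Or.inr (Or.inl h)), hrN⟩
    · exact algRat r halg
    · obtain ⟨r', hr', hrel⟩ := ConicLayer.stub_eulerLeadCell α β γ a b hα hβ hγ ha hb hab hα0 hdisc hpos P Q hQ r hdom hint
      obtain ⟨N, hN, hr'N⟩ := algRat r' hr'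
      refine ⟨N, hN, ?_⟩
      have h := M₁.add_mem (HomotopyInvariance.changeOfVariablesRel_subset hrel) hr'N
      convert h using 1
      abel
    · obtain ⟨r', hr', hrel⟩ := ConicLayer.stub_eulerRootCell α ρ₀ ρ' a b hα hρ₀ hρ' ha hb hab hα0 hρa hbρ' P Q hQ r hdom hint
      obtain ⟨N, hN, hr'N⟩ := algRat r' hr'
      refine ⟨N, hN, ?_⟩
      have h := M₁.add_mem (HomotopyInvariance.changeOfVariablesRel_subset hrel) hr'N
      convert h using 1
      abel
    · obtain ⟨N, hN, hrN⟩ := IsoLayer.isoCells A B hA hB (KZ.of r) (AddSubgroup.subset_closure ⟨r, Or.inr (Or.inl hcell), rfl⟩)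
      exact ⟨N, fun ρ hρ => (hN ρ hρ).elim Or.inl (fun h => Or.inr (Or.inl h)), hrN⟩
    · obtain ⟨N, hN, hrN⟩ := IsoLayer.isoCells A B hA hB (KZ.of r) (AddSubgroup.subset_closure ⟨r, Or.inr (Or.inr htail), rfl⟩)
      exact ⟨N, fun ρ hρ => (hN ρ hρ).elim Or.inl (fun h => Or.inr (Or.inl h)), hrN⟩
    · refine ⟨Finsupp.single r 1, fun ρ hρ => ?_, ?_⟩
      · rw [Finsupp.support_single _ one_ne_zero, Finset.mem_singleton] at hρ
        subst hρ
        exact Or.inr (Or.inr htors)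
      · rw [Finsupp.sum_single_index (zero_zsmul _), one_zsmul, sub_self]
        exact M₁.zero_mem
    · obtain ⟨r', hr', hrr'⟩ := stub_torsTailC (A j) (B j) e M' (hA j) (hB j) he hM' hfe hfe' heM hpos (L j) (hL₂ j) (hL₃ j)
        P D hPD hD0 hDt r hdom hint
      refine ⟨Finsupp.single r' 1, fun ρ hρ => ?_, ?_⟩
      · rw [Finsupp.support_single _ one_ne_zero, Finset.mem_singleton] at hρ
        subst hρ
        exact Or.inr (Or.inr ⟨j, hr'⟩)
      · rw [Finsupp.sum_single_index (zero_zsmul _), one_zsmul]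
        exact hrr'
  · exact ⟨0, by simp, by simp [M₁.zero_mem]⟩
  · rintro c c' _ _ ⟨N, hN, hcN⟩ ⟨N', hN', hcN'⟩
    refine ⟨N + N', fun ρ hρ => ?_, ?_⟩
    · rcases Finset.mem_union.mp (Finsupp.support_add hρ) with h | h
      · exact hN ρ h
      · exact hN' ρ h
    · rw [Cells.combo_add]
      convert M₁.add_mem hcN hcN' using 1
      abel
  · rintro c _ ⟨N, hN, hcN⟩
    refine ⟨-N, fun ρ hρ => hN ρ (by simpa [Finsupp.support_neg] using hρ), ?_⟩
    rw [Cells.combo_neg]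
    convert M₁.neg_mem hcN using 1
    abel

end Layer

/-- **THE UNIFIED UNCONDITIONAL LAYER OF THE CRUX (genus 0 + the non-CM elliptic sector, MIXED relations).**  Let `M_i` (`i ∈ J`,
finite) be pairwise non-isogenous non-CM lattices with algebraic invariants and `E_j : y² = x³ + A_j x + B_j` (`j ∈ ι`) real Weierstrass
curves with lattices `L_j` isogenous (`z ↦ α_j z`) into the `M_{κ j}`.  Every `ℤ`-combination with vanishing value of: rational
representations; algebraic-rational cells `∫_a^b P/Q` (`P, Q ∈ (ℚ̄ ∩ ℝ)[x]`); conic cells `∫_a^b P dx/(Q √(αx² + βx + γ))` (both Euler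
types); first/second-kind elliptic cells and tails on the `E_j`; third-kind `(P, D)`-torsion cells (all complex roots of `D` torsion
abscissae of `E_j`, `D ≠ 0` on `[a, b]`) and torsion tails `∫_M^∞ P dx/(D √f_j)` (`deg P ≤ deg D`) — lies in
`M₁ = closure (1a ∪ 1b ∪ 2 ∪ Green)`.  [cite: HuberWustholz2022, Thm 13.3 (2), §13.2, Ch. 15] [cite: KontsevichZagier2001, §1.2] -/
theorem realOnePeriodRelations_unifiedLayer_family : ∀ {ι J : Type} [Fintype J] [DecidableEq J]
    (A B : ι → ℝ), (∀ j, IsAlgebraic ℚ (A j)) → (∀ j, IsAlgebraic ℚ (B j)) →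
    ∀ (M : J → PeriodPair), (∀ i, IsAlgebraic ℚ (M i).g₂ ∧ IsAlgebraic ℚ (M i).g₃) →
    (∀ i j, i ≠ j → ¬ (M i).IsIsogenousTo (M j)) → (∀ i, ¬ (M i).HasCM) →
    ∀ (L : ι → PeriodPair) (κ : ι → J) (α : ι → ℂ), (∀ j, (L j).g₂ = -4 * (A j : ℂ)) → (∀ j, (L j).g₃ = -4 * (B j : ℂ)) →
    (∀ j, α j ≠ 0) → (∀ j, IsAlgebraic ℚ (α j)) → (∀ j, ∀ l ∈ (L j).lattice, α j * l ∈ (M (κ j)).lattice) →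
    ∀ c : KZ.FormalRep, c ∈ AddSubgroup.closure ((fun r : KZ.IntegralRep 1 => KZ.of r) ''
      {r | r.IsRational ∨
        (∃ a b : ℝ, IsAlgebraic ℚ a ∧ IsAlgebraic ℚ b ∧ a < b ∧ r.domain = {z | z 0 ∈ Set.Ioo a b} ∧
          ∃ P Q : Polynomial (algebraicClosure ℚ ℝ), (∀ x ∈ Set.Ioo a b, Polynomial.aeval x Q ≠ 0) ∧
            ∀ x ∈ Set.Ioo a b, r.integrand (fun _ => x) = Polynomial.aeval x P / Polynomial.aeval x Q) ∨
        (∃ α β γ a b : ℝ, IsAlgebraic ℚ α ∧ IsAlgebraic ℚ β ∧ IsAlgebraic ℚ γ ∧ IsAlgebraic ℚ a ∧ IsAlgebraic ℚ b ∧ a < b ∧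
          0 < α ∧ β ^ 2 - 4 * α * γ ≠ 0 ∧ (∀ x ∈ Set.Icc a b, 0 < α * x ^ 2 + β * x + γ) ∧
          r.domain = {z | z 0 ∈ Set.Ioo a b} ∧
          ∃ P Q : Polynomial (algebraicClosure ℚ ℝ), (∀ x ∈ Set.Icc a b, Polynomial.aeval x Q ≠ 0) ∧
            ∀ z ∈ r.domain, r.integrand z =
              Polynomial.aeval (z 0) P / (Polynomial.aeval (z 0) Q * Real.sqrt (α * (z 0) ^ 2 + β * (z 0) + γ))) ∨
        (∃ α ρ ρ' a b : ℝ, IsAlgebraic ℚ α ∧ IsAlgebraic ℚ ρ ∧ IsAlgebraic ℚ ρ' ∧ IsAlgebraic ℚ a ∧ IsAlgebraic ℚ b ∧ a < b ∧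
          α < 0 ∧ ρ < a ∧ b < ρ' ∧ r.domain = {z | z 0 ∈ Set.Ioo a b} ∧
          ∃ P Q : Polynomial (algebraicClosure ℚ ℝ), (∀ x ∈ Set.Icc a b, Polynomial.aeval x Q ≠ 0) ∧
            ∀ z ∈ r.domain, r.integrand z =
              Polynomial.aeval (z 0) P / (Polynomial.aeval (z 0) Q * Real.sqrt (α * ((z 0) - ρ) * ((z 0) - ρ')))) ∨
        (∃ j, ∃ a b : ℝ, IsAlgebraic ℚ a ∧ IsAlgebraic ℚ b ∧ a < b ∧ r.domain = {z | z 0 ∈ Set.Ioo a b} ∧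
          (∀ x ∈ Set.Ioo a b, 0 < x ^ 3 + A j * x + B j) ∧
          ∃ P₁ P₂ P₃ : Polynomial (algebraicClosure ℚ ℝ), ∀ x ∈ Set.Ioo a b,
            r.integrand (fun _ => x) = Polynomial.aeval x P₁ + Polynomial.aeval x P₂ * Real.sqrt (x ^ 3 + A j * x + B j) +
              Polynomial.aeval x P₃ / Real.sqrt (x ^ 3 + A j * x + B j)) ∨
        (∃ j, ∃ e M' c₀ : ℝ, IsAlgebraic ℚ e ∧ IsAlgebraic ℚ M' ∧ IsAlgebraic ℚ c₀ ∧ e ^ 3 + A j * e + B j = 0 ∧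
          0 < 3 * e ^ 2 + A j ∧ e < M' ∧ (∀ x : ℝ, e < x → 0 < x ^ 3 + A j * x + B j) ∧ r.domain = {z | M' < z 0} ∧
          ∀ z ∈ r.domain, r.integrand z = c₀ / Real.sqrt ((z 0) ^ 3 + A j * (z 0) + B j)) ∨
        (∃ j, ∃ a b : ℝ, IsAlgebraic ℚ a ∧ IsAlgebraic ℚ b ∧ a < b ∧ r.domain = {z | z 0 ∈ Set.Ioo a b} ∧
          (∀ x ∈ Set.Ioo a b, 0 < x ^ 3 + A j * x + B j) ∧
          ∃ P D : Polynomial (algebraicClosure ℚ ℝ), (∀ x ∈ Set.Icc a b, Polynomial.aeval x D ≠ 0) ∧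
            (∀ z : ℂ, Polynomial.aeval z D = 0 →
              ∃ v : ℂ, v ∉ (L j).lattice ∧ (∃ n : ℕ, 1 ≤ n ∧ (n : ℂ) * v ∈ (L j).lattice) ∧ ℘[L j] v = z) ∧
            ∀ x ∈ Set.Ioo a b, r.integrand (fun _ => x) =
              Polynomial.aeval x P / (Polynomial.aeval x D * Real.sqrt (x ^ 3 + A j * x + B j))) ∨
        (∃ j, ∃ e M' : ℝ, IsAlgebraic ℚ e ∧ IsAlgebraic ℚ M' ∧ e ^ 3 + A j * e + B j = 0 ∧ 0 < 3 * e ^ 2 + A j ∧ e < M' ∧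
          (∀ x : ℝ, e < x → 0 < x ^ 3 + A j * x + B j) ∧ r.domain = {z | M' < z 0} ∧
          ∃ P D : Polynomial (algebraicClosure ℚ ℝ), P.natDegree ≤ D.natDegree ∧ (∀ x : ℝ, M' ≤ x → Polynomial.aeval x D ≠ 0) ∧
            (∀ z : ℂ, Polynomial.aeval z D = 0 →
              ∃ v : ℂ, v ∉ (L j).lattice ∧ (∃ n : ℕ, 1 ≤ n ∧ (n : ℂ) * v ∈ (L j).lattice) ∧ ℘[L j] v = z) ∧
            ∀ z ∈ r.domain, r.integrand z =
              Polynomial.aeval (z 0) P / (Polynomial.aeval (z 0) D * Real.sqrt ((z 0) ^ 3 + A j * (z 0) + B j)))}) →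
    KZ.eval c = 0 →
    c ∈ AddSubgroup.closure (KZ.domainAddRel ∪ KZ.integrandAddRel ∪ KZ.changeOfVariablesRel ∪
      {g : KZ.FormalRep | ∃ (Δ : Set (Fin 2 → ℝ)) (A B S : (Fin 2 → ℝ) → ℝ) (r₀₁ r₁₂ r₀₂ : KZ.IntegralRep 1),
        Δ = {p | 0 ≤ p 0 ∧ 0 ≤ p 1 ∧ p 0 + p 1 ≤ 1} ∧ IsSemialgebraicFunOn ℚ Δ A ∧ IsSemialgebraicFunOn ℚ Δ B ∧
        ContinuousOn A Δ ∧ ContinuousOn B Δ ∧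
        (∀ p : Fin 2 → ℝ, 0 < p 0 → 0 < p 1 → p 0 + p 1 < 1 →
          HasFDerivAt S (A p • ContinuousLinearMap.proj (R := ℝ) (φ := fun _ : Fin 2 => ℝ) 0 +
            B p • ContinuousLinearMap.proj (R := ℝ) (φ := fun _ : Fin 2 => ℝ) 1) p) ∧
        r₀₁.domain = {z | z 0 ∈ Set.Ioo 0 1} ∧ r₁₂.domain = {z | z 0 ∈ Set.Ioo 0 1} ∧
        r₀₂.domain = {z | z 0 ∈ Set.Ioo 0 1} ∧ (∀ z ∈ r₀₁.domain, r₀₁.integrand z = A ![z 0, 0]) ∧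
        (∀ z ∈ r₁₂.domain, r₁₂.integrand z = B ![1 - z 0, z 0] - A ![1 - z 0, z 0]) ∧
        (∀ z ∈ r₀₂.domain, r₀₂.integrand z = B ![0, z 0]) ∧ g = KZ.of r₀₁ + KZ.of r₁₂ - KZ.of r₀₂}) := by
  intro ι J _ _ A B hA hB M hM hiso hCM L κ α hL₂ hL₃ hα hαalg hαM c hc heval
  change c ∈ M₁
  have hD : ∀ j, 4 * A j ^ 3 + 27 * B j ^ 2 ≠ 0 := fun j => discr_ne_zero_of_model (L j) (hL₂ j) (hL₃ j)
  have hg₂ : ∀ j, IsAlgebraic ℚ (L j).g₂ := fun j => by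
    rw [hL₂ j]; exact ((isAlgebraic_int 4).neg).mul (hA j).algebraMap
  have hg₃ : ∀ j, IsAlgebraic ℚ (L j).g₃ := fun j => by
    rw [hL₃ j]; exact ((isAlgebraic_int 4).neg).mul (hB j).algebraMap
  refine SectorGlue.realOnePeriodRelations_of_sector _ _ _ (fun C hCalg hCsupp hC0 => ?_)
    (unifiedCells_family A B L hA hB hL₂ hL₃) (torsLayerArcsC_family A B L hA hB hD hL₂ hL₃) c hc heval
  refine huberWustholzCurvePeriods_torsionPunctured_family M hM hiso hCM C hCalg (fun s hs => ?_) hC0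
  rcases hCsupp s hs with ⟨j, T, hT, hZ⟩ | hP | ⟨j, hj⟩
  · exact Or.inl ⟨κ j, L j, α j, hg₂ j, hg₃ j, hα j, hαalg j, hαM j, Or.inr ⟨T, hT, hZ⟩⟩
  · exact Or.inr (Or.inl hP)
  · exact Or.inl ⟨κ j, L j, α j, hg₂ j, hg₃ j, hα j, hαalg j, hαM j,
      Or.inl (hj.trans (Ell.curve_eq_weierCurve (hL₂ j) (hL₃ j)).symm)⟩

end TorsionLayer

end Summit.KontsevichZagierPeriods.SymplecticScissors.RealOnePeriodRelations

end
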